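import Summits.BirchSwinnertonDyer.Rank1Residual.GaloisImage.KolyvaginFiniteSingularTorsion
import Summits.BirchSwinnertonDyer.Rank1Residual.GaloisImage.KolyvaginDerivativeUnramifiedTate
import Summits.BirchSwinnertonDyer.Rank1Residual.GaloisImage.SelmerClassInertiaConverse
import Literature.NumberTheory.GaloisRepresentations.ContinuousH1OrderTwo
import Literature.NumberTheory.GaloisRepresentations.LocalGlobalCohomologyDualityProofs
import Literature.NumberTheory.EllipticCurves.ArchimedeanKummerImageMaximal
import HarnessLib

/-!
# THEOREM D (core) of row T-DER: the derivative family of an Euler system of `T_p E / ℚ` IS a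
# Kolyvagin system for `(E[m], 𝓕, 𝒫)` — place-by-place assembly with the `S`-places displayed
# (cell `b2b-bsdres`, n1011 p11 GEN 10; row T-DER, THEOREM D file D3)

HONEST FRAMING (cell `b2b-bsdres`, run/shared/lean/b2b/bsd-rank1-residual/, verbatim in every
file): the goal of the cell is to DELETE the COMBINATION-SHAPED residual classes of the
Birch–Swinnerton-Dyer formula for ALL analytic-rank `≤ 1` elliptic curves over `ℚ` — "full BSD
formula for every rank `≤ 1` curve in class `C`" assembled STRICTLY from published theorems — so
that the rank-`≤ 1` remainder becomes exactly the CONSTRUCTION-SHAPED classes, which are TYPED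
(missing-input `Prop`s), NOT attempted. This is not "finishing BSD". Team n1011: research route on
the CONSTRUCTION-SHAPED class X4 / §I N11 (route-1 PORT, (P-DER), clause C1/C0); TOOL theorem: NO
Euler system is asserted to exist (it is the hypothesis `hc`), no definition, no named fact, no
`sorry`.

## What

[MR04] Thm. 3.2.4 / App. A turn an Euler system into a Kolyvagin system by Kolyvagin's derivative
followed by the unitriangular modification (33); at Kim's / Sakamoto's primes of level `n`
(`q ≡ 1`, `a_q ≡ q + 1 (mod p^n)`, so `P_q(x) ≡ (x − 1)²`, Kim AJM 2026 §2.3.2; n1011-p13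
`TorsionComparison.comparisonP_torsion_eq_sq_of_isKolyvaginPrime`) the modification is the
IDENTITY, so THEOREM D says: the derivative family itself is a Kolyvagin system.  This file is the
PURE ASSEMBLY, for ANY Selmer structure `𝓕` on `E[m]` and ANY family
`κ : Finset → H¹(ℚ, E[m])` vanishing off the levels `𝒩 = {d ⊆ 𝒫}` (`hκ0`) and characterised at
every level by `res_{U_d} (κ d) = D_d (Φ_d (red_* c_{0,d}))` (`hκ`; D2
`Derivative.Rat.exists_derivativeFamily` produces such a family for a FIXED choice of generators `σ`,
D1 `CyclotomicLevel.Rat.exists_sigma_mem_inertia_adicCompletionPrime` the generators):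
**`D.IsKolyvaginSystem 𝓕 κ`** (`KolyvaginSystems.lean`, Sakamoto Def. 4.1 / Kim §2.2.2 / Rubin PCMI
Def. 2.2.1) from
* (i) the finite–singular relation — C5b-β `singularLocalization_eq_fsLocalization_of_eulerSystem`,
  DISCHARGED here (needs `q ∈ 𝒫` Kolyvagin of level `n`, `σ_q ∈ I_{𝔓₀(q)}`, `χ_{Nq}(σ_q) = η_q`,
  `D.HasCanonicalComparison (p^n) η`);
* (ii) the unramified clause at EVERY good place `w ≠ p`, `w ∉ d` (inside or outside `S`) —
  THEOREM B-ur (F8 `apply_eq_zero_of_resSubgroup_eq_deriv_tate` + F9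
  `SelmerFinite.localization_transport_mem_unramifiedSubgroup`; `Gal(ℚ̄/ℚ(μ_d))` is unramified at
  `w ∉ d`, `subgroupIsUnramifiedAt_level_bot`), DISCHARGED here, composed with the displayed
  `hunr : H¹_ur ≤ 𝓕_w` there (for `𝓕_can`: `propagatedSelmerStructure_inr_eq_unramifiedSubgroup`);
* (iii) the infinite places — `H¹(ℝ, E[m]) = 0` for `m = p^n` odd, DISCHARGED here;
* (iv) the transverse clause at `q ∈ d` — DISPLAYED (`htr`; T-DER-TR, n1011-p15
  `Transverse.Rat.localization_map_deriv_mem_cyclotomicTransverse`);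
* (v) the finitely many BAD places and the place `p`, off `d` — DISPLAYED (`hSloc`; per row
  class: F10/F11/F12/T-DER-BP/T-DER-BN/GZ-4).
Honest: (iv) and (v) are hypotheses of this theorem, not claims; no Euler system is asserted.
0 defs, 0 facts.  References: B. Mazur, K. Rubin, Mem. AMS 799 (2004), Thm. 3.2.4, App. A
Prop. A.2, Thm. A.4, (33); K. Rubin, *Euler Systems* (2000), Def. 4.4.10, Thm. 4.5.1, Thm. 4.5.4;
R. Sakamoto, JTNB 36 (2024), Def. 4.1; C.-H. Kim, arXiv:2203.12159, §2.2.2, §2.3.2.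
-/

noncomputable section

open CategoryTheory Function Finset Polynomial Field IsDedekindDomain
open scoped NumberField
open Literature.NumberTheory.GaloisRepresentations Literature.NumberTheory.EllipticCurves
open Literature.NumberTheory.GaloisRepresentations.DiscreteGaloisModule
open Literature.NumberTheory.GaloisCohomology
open Summit.BirchSwinnertonDyer.Rank1Residual.GaloisImage.CoeffTransport
open Summit.BirchSwinnertonDyer.Rank1Residual.GaloisImage.CyclotomicLevel
open Rat.HeightOneSpectrum

universe u

namespace Summit.BirchSwinnertonDyer.Rank1Residual.GaloisImage.Derivative.Rat

variable (W : WeierstrassCurve ℚ) [W.IsElliptic] [W.IsGloballyMinimal] (p : ℕ) [Fact p.Prime]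
variable [Module.Free ℤ_[p] (W.tateModule p)] [Module.Finite ℤ_[p] (W.tateModule p)]
  [ContinuousSMul ℤ_[p] (W.tateModule p)]

/-- Local notation: `T∞ = T_p E` as a continuous `G_ℚ`-representation. -/
local notation3 "T∞" => WeierstrassCurve.tateGaloisRep W p (W.continuous_galoisRepTate_holds p)

/-- Local notation: `𝐫⟦f, T′, U⟧ = f_* : H¹(U, T_pE) → H¹(U, T′)`. -/
local notation3 (prettyPrint := false) "𝐫⟦" f ", " Tg ", " U "⟧" =>
  ContinuousCohomology.map (ContinuousMonoidHom.id _)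
    (X := subgroupRep (ContinuousRep.toTopRep T∞) U)
    (Y := subgroupRep (ContinuousRep.toTopRep Tg) U)
    ((TopRep.resFunctor (Subgroup.subtype U)).map f) 1

variable (S : Set (HeightOneSpectrum (𝓞 ℚ)))

/-- Local notation: `𝓛` = the cyclotomic Euler-system levels `ℚ(μ_{p^{n+1}}, μ_r)`, `r ∩ S = ∅`. -/
local notation3 "𝓛" => cyclotomicLevelsRat p S

/-- Local notation: `𝐃⟦A, X, U, τ⟧ ℓ = ∑_{j < ℓ−1} j·(τ_ℓ)_*^j`, Kolyvagin's derivative operator of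
the place `ℓ` on `H¹(U, X)` (`A`-linear) for the generator `τ_ℓ`. -/
local notation3 (prettyPrint := false) "𝐃⟦" A ", " X ", " U ", " τ "⟧" =>
  fun ℓ : HeightOneSpectrum (𝓞 ℚ) =>
  ∑ j ∈ Finset.range (((primesEquiv ℓ : Nat.Primes) : ℕ) - 1),
    (j : Module.End A (continuousCohomology 1 (subgroupRep X U))) *
      (conjMap X U ((τ : HeightOneSpectrum (𝓞 ℚ) → absoluteGaloisGroup ℚ) ℓ) 1).hom.toLinearMap ^ j

omit [W.IsElliptic] [W.IsGloballyMinimal] [Module.Free ℤ_[p] (W.tateModule p)]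
  [Module.Finite ℤ_[p] (W.tateModule p)] [ContinuousSMul ℤ_[p] (W.tateModule p)] in
/-- **`Gal(ℚ̄/ℚ(μ_r))` is unramified at every finite place `w ∉ r`** (the bottom `p`-layer of
`cyclotomicLevelsRat p S`; `ℚ(μ_ℓ)/ℚ` is unramified at `w ≠ ℓ`, tree
`rootsOfUnityFixer_unramifiedAt_of_not_mem`) — for `w ∈ S` as well, which
`EulerSystemLevels.level_unramifiedAt` does not cover. [folklore] -/
theorem subgroupIsUnramifiedAt_level_bot (r : Finset (HeightOneSpectrum (𝓞 ℚ)))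
    {w : HeightOneSpectrum (𝓞 ℚ)} (hwr : w ∉ r) :
    SubgroupIsUnramifiedAt ℚ ((𝓛).level ⊥ r) w := by
  intro 𝔓 h𝔓 g hg
  refine mem_level_of_forall 𝓛 (by rw [(𝓛).pLevel_bot]; exact Subgroup.mem_top _) fun q hq => ?_
  have hne : ((primesEquiv w : Nat.Primes) : ℕ) ≠ ((primesEquiv q : Nat.Primes) : ℕ) := fun h =>
    hwr ((primesEquiv.injective (Subtype.ext h)) ▸ hq)
  haveI : NeZero ((primesEquiv q : Nat.Primes) : ℕ) := ⟨(primesEquiv q).2.ne_zero⟩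
  rw [CyclotomicLevel.Rat.cyclotomicLevelsRat_tameLevel]
  exact rootsOfUnityFixer_unramifiedAt_of_not_mem ℚ _
    (WeierstrassCurve.natCast_not_mem_asIdeal_of_primesEquiv_ne (primesEquiv q).2 hne) 𝔓 h𝔓 hg

omit [W.IsElliptic] [W.IsGloballyMinimal] [Module.Free ℤ_[p] (W.tateModule p)]
  [Module.Finite ℤ_[p] (W.tateModule p)] [ContinuousSMul ℤ_[p] (W.tateModule p)] in
/-- **`H¹(ℝ, E[m]) = 0` for `m = p^n`, `p` odd**: every local class at an infinite place vanishes
(`Γ_ℝ` has order `≤ 2`, `E[m]` is killed by the odd number `m`). [cite: MilneADT2006, I Rem. 3.7] -/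
theorem localization_inl_eq_zero_of_odd (hp2 : p ≠ 2) {n : ℕ} {m : ℤ} (hm : m = ((p ^ n : ℕ) : ℤ))
    (w : NumberField.InfinitePlace ℚ)
    (y : galoisCohomology ((W.torsionGaloisModule m).toLocal (Sum.inl w)) 1) : y = 0 := by
  have hodd : Odd m.natAbs := by
    rw [hm, Int.natAbs_natCast]
    exact ((Fact.out : p.Prime).odd_of_ne_two hp2).pow
  exact eq_zero_of_odd_nsmul_eq_zero_infinitePlace w _ hodd y
    (galoisCohomology.nsmul_eq_zero_of_forall _ (fun T => W.natAbs_nsmul_geomTorsion T) y)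

/-- **THEOREM D (core): the derivative family of an Euler system of `T_pE` is a Kolyvagin system
for `(E[m], 𝓕, 𝒫)`, the transverse clause and the `S`-places displayed** (see the module docstring
for every binder; `𝒫 = D.primes` ⊆ Kolyvagin primes of level `n` off `S ∪ {p}`, `m = p^n`).
[cite: MazurRubin2004, Thm. 3.2.4 and App. A (Prop. A.2, Thm. A.4, (33))]
[cite: Rubin2000, Thm. 4.5.1 and Thm. 4.5.4] [cite: Sakamoto2024, Def. 4.1 (p. 926)]
[cite: Kim2022StructureSelmer, §2.2.2 and §2.3.2] -/
theorem isKolyvaginSystem_derivativeFamily (hp2 : p ≠ 2)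
    {c : ∀ (i : ℕ) (r : (𝓛).Ideals), H1 T∞ ((𝓛).level i r.1)}
    (hc : IsEulerSystem 𝓛 T∞ p c)
    {M' : Type} [AddCommGroup M'] [Module ℤ_[p] M'] [TopologicalSpace M'] [IsTopologicalAddGroup M']
    [ContinuousSMul ℤ_[p] M'] {T' : GaloisRep ℚ ℤ_[p] M'} (red : T∞.toTopRep ⟶ T'.toTopRep)
    (hred : Function.Surjective red.hom)
    {n : ℕ} (hn : 0 < n) (hM : ∀ m : M', ((p : ℤ_[p]) ^ n) • m = 0)
    {m : ℤ} (hm : m = ((p ^ n : ℕ) : ℤ))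
    [Module (ZMod (p ^ n)) (WeierstrassCurve.geomTorsion W m)]
    [Module.Free (ZMod (p ^ n)) (WeierstrassCurve.geomTorsion W m)]
    [Module.Finite (ZMod (p ^ n)) (WeierstrassCurve.geomTorsion W m)]
    (e : M' →+ WeierstrassCurve.geomTorsion W m) (hec : Continuous e)
    (he : ∀ (g : absoluteGaloisGroup ℚ) (x : M'),
      e (T'.toTopRep.ρ g x) = (W.torsionGaloisModule m).toTopRep.ρ g (e x))
    (einv : WeierstrassCurve.geomTorsion W m →+ M') (hic : Continuous einv)
    (h₁ : ∀ x, einv (e x) = x) (h₂ : ∀ y, e (einv y) = y)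
    (D : KolyvaginDatum (W.torsionGaloisModule m))
    {η : (ℓ : HeightOneSpectrum (𝓞 ℚ)) → (ZMod (Ideal.absNorm ℓ.asIdeal))ˣ}
    (hD : D.HasCanonicalComparison (p ^ n) η)
    (hPr : D.primes ⊆ (𝓛).primes)
    (hKol : ∀ ℓ ∈ D.primes, Kato.IsKolyvaginPrime W p n ((primesEquiv ℓ : Nat.Primes) : ℕ))
    (σ : HeightOneSpectrum (𝓞 ℚ) → absoluteGaloisGroup ℚ)
    (hσI : ∀ ℓ ∈ D.primes, σ ℓ ∈ (adicCompletionPrime ℚ ℓ).inertia (absoluteGaloisGroup ℚ))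
    (hσχ : ∀ ℓ ∈ D.primes, modNCyclotomicCharacter ℚ (Ideal.absNorm ℓ.asIdeal) (σ ℓ) = η ℓ)
    (hσ : ∀ r : Finset (HeightOneSpectrum (𝓞 ℚ)), (↑r : Set _) ⊆ D.primes →
      (∀ ℓ ∈ r, ∀ ℓ₂ ∈ r, ℓ₂ ≠ ℓ → σ ℓ ∈ (𝓛).tameLevel ℓ₂) ∧
      (∀ ℓ ∈ r, ∀ g : absoluteGaloisGroup ℚ,
        ∃ j < ((primesEquiv ℓ : Nat.Primes) : ℕ) - 1, (σ ℓ ^ j)⁻¹ * g ∈ (𝓛).tameLevel ℓ) ∧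
      (∀ ℓ ∈ r, ∀ j₁ < ((primesEquiv ℓ : Nat.Primes) : ℕ) - 1,
        ∀ j₂ < ((primesEquiv ℓ : Nat.Primes) : ℕ) - 1,
          (σ ℓ ^ j₁)⁻¹ * σ ℓ ^ j₂ ∈ (𝓛).tameLevel ℓ → j₁ = j₂))
    (h0 : ∀ r : Finset (HeightOneSpectrum (𝓞 ℚ)), (↑r : Set _) ⊆ D.primes →
      ∀ P : WeierstrassCurve.geomTorsion W m,
        (∀ u : (𝓛).level ⊥ r, (u : absoluteGaloisGroup ℚ) • P = P) → P = 0)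
    (Φ : ∀ r : Finset (HeightOneSpectrum (𝓞 ℚ)),
        continuousCohomology 1 (subgroupRep T'.toTopRep ((𝓛).level ⊥ r)) →+
          continuousCohomology 1 (subgroupRep (W.torsionGaloisModule m).toTopRep ((𝓛).level ⊥ r)))
    (hΦ : ∀ r, ∀ (φ : contOneCocycles (subgroupRep T'.toTopRep ((𝓛).level ⊥ r)))
      (ψ : contOneCocycles (subgroupRep (W.torsionGaloisModule m).toTopRep ((𝓛).level ⊥ r))),
      (∀ g, ψ.1 g = e (φ.1 g)) → Φ r (oneCocycleClass _ φ) = oneCocycleClass _ ψ)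
    (comm : ∀ r : Finset (HeightOneSpectrum (𝓞 ℚ)),
        ((r : Finset _) : Set (HeightOneSpectrum (𝓞 ℚ))).Pairwise fun a b =>
          Commute (𝐃⟦ℤ, (W.torsionGaloisModule m).toTopRep, ((𝓛).level ⊥ r), σ⟧ a)
            (𝐃⟦ℤ, (W.torsionGaloisModule m).toTopRep, ((𝓛).level ⊥ r), σ⟧ b))
    (κ : Finset (HeightOneSpectrum (𝓞 ℚ)) → galoisCohomology (W.torsionGaloisModule m) 1)
    (hκ0 : ∀ r : Finset (HeightOneSpectrum (𝓞 ℚ)), ¬ (↑r : Set _) ⊆ D.primes → κ r = 0)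
    (hκ : ∀ (r : Finset (HeightOneSpectrum (𝓞 ℚ))) (hr : (↑r : Set _) ⊆ D.primes),
      resSubgroup (W.torsionGaloisModule m).toTopRep ((𝓛).level ⊥ r) 1 (κ r) =
        (r.noncommProd 𝐃⟦ℤ, (W.torsionGaloisModule m).toTopRep, ((𝓛).level ⊥ r), σ⟧ (comm r))
          (Φ r (𝐫⟦red, T', ((𝓛).level ⊥ r)⟧
            (c ⊥ ⟨r, fun _ hq => hPr (hr (Finset.mem_coe.2 hq))⟩))))
    (𝓕 : SelmerStructure (W.torsionGaloisModule m))
    (hunr : ∀ w : HeightOneSpectrum (𝓞 ℚ), W.HasGoodReductionAt w →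
      ((primesEquiv w : Nat.Primes) : ℕ) ≠ p →
        unramifiedSubgroup (GaloisRep.toLocal w (W.torsionGaloisModule m)) 1 ≤ 𝓕 (Sum.inr w))
    (hSloc : ∀ (r : Finset (HeightOneSpectrum (𝓞 ℚ))), (↑r : Set _) ⊆ D.primes →
      ∀ w : HeightOneSpectrum (𝓞 ℚ), w ∉ r →
        ¬ (W.HasGoodReductionAt w ∧ ((primesEquiv w : Nat.Primes) : ℕ) ≠ p) →
          galoisCohomology.localization (W.torsionGaloisModule m) (Sum.inr w) 1 (κ r) ∈ 𝓕 (Sum.inr w))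
    (htr : ∀ (r : Finset (HeightOneSpectrum (𝓞 ℚ))), (↑r : Set _) ⊆ D.primes → ∀ q ∈ r,
      galoisCohomology.localization (W.torsionGaloisModule m) (Sum.inr q) 1 (κ r) ∈
        D.transverse (Sum.inr q)) :
    D.IsKolyvaginSystem 𝓕 κ := by
  classical
  -- `T′` is unramified at every good `w ∤ p` (through `e`)
  have hX'I : ∀ (w : HeightOneSpectrum (𝓞 ℚ)), W.HasGoodReductionAt w →
      ((p : ℕ) : 𝓞 ℚ) ∉ w.asIdeal → ∀ 𝔓 ∈ w.primesAbove,
        ∀ u ∈ 𝔓.inertia (absoluteGaloisGroup ℚ), ∀ x : M', T'.toTopRep.ρ u x = x := by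
    intro w hw hpw 𝔓 h𝔓 u hu x
    have hmw : ((m : ℤ) : 𝓞 ℚ) ∉ w.asIdeal := by
      rw [hm, Int.cast_natCast, Nat.cast_pow]
      exact fun h => hpw (w.isPrime.mem_of_pow_mem n h)
    have h := he u x
    rw [show (W.torsionGaloisModule m).toTopRep.ρ u (e x) = e x from by
      change W.torsionGaloisModule m u (e x) = e x
      rw [WeierstrassCurve.torsionGaloisModule_apply_apply]
      exact W.smul_geomTorsion_eq_of_mem_inertia hw hmw h𝔓 hu (e x)] at h
    have h' := congrArg einv h
    rwa [h₁, h₁] at h'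
  -- the global transport (GZ-1)
  obtain ⟨Φ₀, hΦ₀⟩ := exists_addEquiv_oneCocycleClass T'.toTopRep (W.torsionGaloisModule m).toTopRep
    e hec he einv hic h₁ h₂
  refine ⟨hκ0, fun d hd => ?_, fun d hd q hq hqd => ?_⟩
  · -- Selmer membership at every place
    rw [SelmerStructure.mem_selmerGroup_iff]
    rintro (w | w)
    · -- infinite place: the local class vanishes
      rw [localization_inl_eq_zero_of_odd W p hp2 hm w
        (galoisCohomology.localization (W.torsionGaloisModule m) (Sum.inl w) 1 (κ d))]
      exact zero_mem _
    · change _ ∈ SelmerStructure.modify 𝓕 D.transverse ∅ ∅ d (Sum.inr w)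
      by_cases hwd : w ∈ d
      · -- transverse clause (displayed)
        rw [SelmerStructure.modify_inr_of_mem_transverse _ _ (Finset.notMem_empty w)
          (Finset.notMem_empty w) hwd]
        exact htr d hd w hwd
      · rw [SelmerStructure.modify_inr_of_not_mem _ _ (Finset.notMem_empty w)
          (Finset.notMem_empty w) hwd]
        by_cases hw : W.HasGoodReductionAt w ∧ ((primesEquiv w : Nat.Primes) : ℕ) ≠ p
        · -- good place `w ≠ p` off `d`: unramified (THEOREM B-ur, F8 + F9)
          refine hunr w hw.1 hw.2 ?_
          have hpw : ((p : ℕ) : 𝓞 ℚ) ∉ w.asIdeal :=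
            WeierstrassCurve.natCast_not_mem_asIdeal_of_primesEquiv_ne Fact.out hw.2
          -- pull the class back to `H¹(ℚ, T′)`
          have hκX := resSubgroup_symm_eq_noncommProd_deriv T'.toTopRep
            (W.torsionGaloisModule m).toTopRep e hec he einv h₁ h₂ ((𝓛).level ⊥ d) Φ₀ hΦ₀ (Φ d)
            (hΦ d) σ _ d (pairwise_commute_deriv (L := 𝓛) (T' := T') ⊥ d σ
              (fun ℓ => ((primesEquiv ℓ : Nat.Primes) : ℕ) - 1)) (comm d) _ (κ d) (hκ d hd)
          rw [← Φ₀.apply_symm_apply (κ d)]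
          exact SelmerFinite.localization_transport_mem_unramifiedSubgroup T'.toTopRep
            (W.torsionGaloisModule m) e hec he Φ₀.toAddMonoidHom (fun φ ψ h => hΦ₀ φ ψ h) w
            (Φ₀.symm (κ d)) fun φ hφ 𝔓 h𝔓 g hg =>
              apply_eq_zero_of_resSubgroup_eq_deriv_tate W p (W.continuous_galoisRepTate_holds p)
                ((𝓛).isOpen_level ⊥ d) (subgroupIsUnramifiedAt_level_bot p S d hwd) hpw hw.1 red
                (hX'I w hw.1 hpw) _ d σ _ _ (Φ₀.symm (κ d)) hκX φ hφ h𝔓 hg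
        · -- the finitely many bad places and `p` (displayed)
          exact hSloc d hd w hwd hw
  · -- the finite–singular relation (C5b-β)
    have hqP : q ∈ (𝓛).primes := hPr hq
    have hdq : (↑(insert q d) : Set _) ⊆ D.primes := by
      rw [Finset.coe_insert]
      exact Set.insert_subset hq hd
    exact singularLocalization_eq_fsLocalization_of_eulerSystem W p S hp2 hc red hred hn hM hm e hec he
      einv hic h₁ h₂ ⟨d, fun _ hq' => hPr (hd (Finset.mem_coe.2 hq'))⟩ hqP hqd (hKol q hq) D hD hq σ
      (hσ _ hdq).1 (hσ _ hdq).2.1 (hσ _ hdq).2.2 (hσI q hq) (hσχ q hq) (h0 _ hdq) (Φ (insert q d))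
      (hΦ (insert q d)) (Φ d) (hΦ d) (comm (insert q d)) (κ (insert q d)) (hκ (insert q d) hdq)
      (comm d) (κ d) (hκ d hd)

end Summit.BirchSwinnertonDyer.Rank1Residual.GaloisImage.Derivative.Rat

end
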